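import Literature.Computability.AlgebraicComplexity.KoiranPortierTavenas2015.WronskianZeroBounds
import Literature.Computability.AlgebraicComplexity.KoiranPortierTavenas2015.AnswerNo
import HarnessLib

/-!
# Koiran–Portier–Tavenas 2015, Theorem 9 (stated §2, proved §5): the refined Wronskian bound,
# with Frobenius' Lemma 21 (PROVED)

P. Koiran, N. Portier, S. Tavenas, *A Wronskian approach to the real τ-conjecture*, J. Symbolic
Comput. **68**:2 (2015) 195–214 = arXiv:1205.1015 [KoiranPortierTavenas2015]; held text
`paper:arxiv-1205.1015` (numbering of that text, as in the sibling files). THEOREMS ONLY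
(0 definitions, 0 named facts); sequel of `WronskianZeroBounds.lean` (Lemmas 3–5, Thms. 7–8), same
vocabulary (`wronskian f m = W(f 0, …, f (m−1))`, `realZeros`, zero sets
`{y | y ∈ Δ ∧ g y = 0}` counted by `Set.encard` in `ℕ∞`). Printed statements:

* **Theorem 9** (p0005:L91): "Let `f_1, …, f_k` be analytic linearly independent functions on an
  interval `I`. Then `Z(f_1 + ⋯ + f_k) ≤ k − 1 + Z(W_k) + Z(W_{k−1}) + 2 Σ_{j=1}^{k−2} Z(W_j)`."
  — `KPT2015_thm_9` (open interval; in `ℕ∞`; the linear-independence hypothesis is dropped, see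
  below), `KPT2015_thm_9_real` (`I = ℝ`, `realZeros`), `KPT2015_thm_9_attained` (equality for
  the sibling file's witness `(x, x² − 1/2, x⁴ − 6x² − x + 9/2)`).
* **Lemma 21 (Frobenius)** (p0011:L24–33): "`R_0 = f_1 + ⋯ + f_k`,
  `R_{i+1} = (W_{i+1}²/W_i)(R_i/W_{i+1})'`. Then the functions `R_i` are analytic and
  `R_{k−1} = W_k`." — rendered without denominators as the determinantal identity
  `W(f_1..f_i) · W(f_1..f_{i+1}, g) = W(f_1..f_{i+1}) · W(f_1..f_i, g)' − W(f_1..f_{i+1})' ·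
  W(f_1..f_i, g)` (`wronskian_frobenius`; so `R_i = W(f_1, …, f_i, R_0)`, analytic as a
  Wronskian, `analyticAt_wronskian`) and `W(f_1..f_{k−1}, f_1+⋯+f_k) = W_k`
  (`wronskian_lastCol_sum`).

**Typed-vs-printed (honest scope).** (1) Open intervals only (`IsOpen Δ`, `IsPreconnected Δ`), as
in the sibling file. `-- TODO(general form): non-open intervals.` (2) "Linearly independent" is
not assumed: by Lemma 5 it is equivalent to `W_k ≢ 0` and only makes the right-hand side finite;
the typed inequality holds for every analytic family (with value `⊤` on the right when some
`W_j ≡ 0`). (3) Families are indexed from `0` and `k ≥ 1` is explicit. (4) **The printed proof is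
repaired, not followed verbatim, at one point.** §5 (p0011:L40–75) runs the induction "`R_i` has at
least `Z(f_1+⋯+f_k) − i − Z(W_i) − 2Σ_{j<i} Z(W_j)` roots" through a bookkeeping of multiplicities
of the meromorphic functions `R_i/W_{i+1}` that asserts: "if `x` is such that
`0 < m_x(R_i) < m_x(W_{i+1})` then … `m_x(R_{i+1}) ≥ m_x(W_{i+1}) − 1 > 0`". This sentence is
false: for `k = 3`, `(f_1, f_2, f_3) = (x², x, 1)` one has `R_1 = W(x², x²+x+1) = −x² − 2x`
(`m_0 = 1`), `W_2 = W(x², x) = −x²` (`m_0 = 2`), but `R_2 = W_3 = W(x², x, 1) = −2` does not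
vanish at `0`. The inequality the induction actually needs, `Z(R_{i+1}) ≥ Z(R_i) − 1 − Z(W_{i+1})
− Z(W_i)`, is nevertheless true and is proved here (`encard_zeros_le_of_wronskian_step`) by the
component count of the proof of Thm. 8: off the zero set `P` of `W_{i+1}`, `(R_i/W_{i+1})' =
W_i R_{i+1}/W_{i+1}²` and Rolle applies on each of the `|P| + 1` components; AT a point of `P`, a
zero of `R_i` is a zero of `W_i R_{i+1} = W_{i+1} R_i' − W_{i+1}' R_i`. The statement of Thm. 9 is
unaffected (and attained, `KPT2015_thm_9_attained`). Nothing of §§3–4, 6 is typed here (Thm. 12,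
the `Σ_i Π_j f_j^{α_ij}` bound the routes consume, is a separate later file).

**Proof of Lemma 21** (ours; the paper cites [Fro76, Pol22, NY95]): induction on `i`; on a ball
where `f_0 ≠ 0`, Lemma 4 (`KPT2015_lemma_4_analytic`, `wronskian_mix_div`) expresses all four
Wronskians through the family `((f_{j+1}/f_0)')_j, (g/f_0)'` and powers of `f_0`, and the identity
at level `i + 1` is `f_0^{2i+4}` times the identity at level `i`; across the zeros of `f_0` it
extends by the identity principle (`AnalyticOnNhd.eqOn_zero_of_preconnected_of_eventuallyEq_zero`).

Consumers / context: as for the sibling file — routes `RealTau.lean` ("KPT Wronskian inequality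
Thm 9/12"), `LacunarySymmetroid.lean`, `SymmetroidDescartes.lean`; `AnswerNo.lean` (the §6 question
and Tavenas' 5.10 = Thm. 9 with all coefficients `1`, both refuted there;
`smoke_kpt_thm9_equality`).
Cell `val-lit` (t14 g9, own pick, lead-lmr RULING #4). Honest framing: a 2015 real-analysis bound
becoming a theorem of the tree; nothing here bears on VP versus VNP.

## References

* [KoiranPortierTavenas2015] P. Koiran, N. Portier, S. Tavenas, *A Wronskian approach to the real
  τ-conjecture*, J. Symbolic Comput. 68 (2015) 195–214, doi:10.1016/j.jsc.2014.09.036,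
  arXiv:1205.1015 — Thm. 9 (p0005:L91), §5 with Lemma 21 (p0011).
* G. Frobenius, *Ueber die Determinante mehrerer Functionen einer Variabeln*, J. reine angew.
  Math. 77 (1874) 245–257 (Lemma 21 as cited in print, "[Fro76]").
-/

noncomputable section

open scoped Topology
open Set

namespace Literature.Computability.AlgebraicComplexity.KoiranPortierTavenas2015

/-! ### Analyticity and elementary algebra of Wronskians -/

/-- A Wronskian of functions analytic at `y` is analytic at `y` (it is a signed sum of products of
iterated derivatives). [cite: KoiranPortierTavenas2015, §5 (Lemma 21: "the functions `R_i` are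
analytic")] -/
theorem analyticAt_wronskian (f : ℕ → ℝ → ℝ) (n : ℕ) {y : ℝ}
    (hf : ∀ j < n, AnalyticAt ℝ (f j) y) : AnalyticAt ℝ (wronskian f n) y := by
  change AnalyticAt ℝ (fun x => (Matrix.of fun r c : Fin n => iteratedDeriv (r : ℕ) (f c) x).det) y
  simp only [Matrix.det_apply', Matrix.of_apply]
  refine Finset.analyticAt_fun_sum _ fun σ _ => analyticAt_const.mul ?_
  refine Finset.analyticAt_fun_prod _ fun c _ => ?_
  have h := (hf c c.isLt).iterated_deriv ((σ c : Fin n) : ℕ)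
  rwa [← iteratedDeriv_eq_iterate] at h

/-- A Wronskian of functions analytic on `Δ` is analytic on `Δ`.
[cite: KoiranPortierTavenas2015, §5 (Lemma 21)] -/
theorem analyticOnNhd_wronskian (f : ℕ → ℝ → ℝ) (n : ℕ) {Δ : Set ℝ}
    (hf : ∀ j < n, AnalyticOnNhd ℝ (f j) Δ) : AnalyticOnNhd ℝ (wronskian f n) Δ :=
  fun y hy => analyticAt_wronskian f n fun j hj => hf j hj y hy

/-- The Wronskian at `y` only depends on the germs at `y` of the first `n` functions.
[cite: KoiranPortierTavenas2015, §2 (definition of `W`)] -/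
theorem wronskian_congr_of_eventuallyEq {f g : ℕ → ℝ → ℝ} {n : ℕ} {y : ℝ}
    (h : ∀ j < n, f j =ᶠ[𝓝 y] g j) : wronskian f n y = wronskian g n y := by
  unfold wronskian
  congr 1
  ext r c
  simp only [Matrix.of_apply]
  exact (h c c.isLt).iteratedDeriv_eq r

/-- The Wronskian only depends on the first `n` functions of the family.
[cite: KoiranPortierTavenas2015, §2 (definition of `W`)] -/
theorem wronskian_congr {f g : ℕ → ℝ → ℝ} {n : ℕ} (h : ∀ j < n, f j = g j) :
    wronskian f n = wronskian g n := by
  funext y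
  exact wronskian_congr_of_eventuallyEq fun j hj => by rw [h j hj]

/-- A Wronskian one of whose functions vanishes near `y` vanishes at `y` (a zero column).
[cite: KoiranPortierTavenas2015, §2 (definition of `W`)] -/
theorem wronskian_eq_zero_of_eventuallyEq_zero {f : ℕ → ℝ → ℝ} {n j : ℕ} {y : ℝ} (hj : j < n)
    (h : f j =ᶠ[𝓝 y] fun _ => (0 : ℝ)) : wronskian f n y = 0 := by
  unfold wronskian
  refine Matrix.det_eq_zero_of_column_eq_zero ⟨j, hj⟩ fun r => ?_
  simp only [Matrix.of_apply]
  rw [h.iteratedDeriv_eq, iteratedDeriv_const]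
  simp

/-- `W_0 = 1` (the empty Wronskian; the convention "`W_0 = 1`" of §5, p0011:L19).
[cite: KoiranPortierTavenas2015, §5] -/
theorem wronskian_zero (f : ℕ → ℝ → ℝ) : wronskian f 0 = fun _ => 1 := by
  funext y
  rw [wronskian_eq_bd17_wronskian, BD17.wronskian_fin_zero]

/-- `W_1 = f_0` as functions. [cite: KoiranPortierTavenas2015, §2] -/
theorem wronskian_one (f : ℕ → ℝ → ℝ) : wronskian f 1 = f 0 :=
  funext fun y => wronskian_one_apply f y

/-- **The last function may be replaced by the sum** (`det` is linear in the last column and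
alternating): `W(f_0, …, f_{n−1}, f_0 + ⋯ + f_n) = W(f_0, …, f_n)` at a point where all `f_i` are
analytic. This is "`R_{k−1} = W_k`" of Lemma 21 with `R_0 = f_1 + ⋯ + f_k` (p0011:L24–33).
[cite: KoiranPortierTavenas2015, Lemma 21] -/
theorem wronskian_lastCol_sum (f : ℕ → ℝ → ℝ) (n : ℕ) {y : ℝ}
    (hf : ∀ j < n + 1, AnalyticAt ℝ (f j) y) :
    wronskian (fun j => if j < n then f j else fun z => ∑ i ∈ Finset.range (n + 1), f i z)
        (n + 1) y = wronskian f (n + 1) y := by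
  classical
  set M : Matrix (Fin (n + 1)) (Fin (n + 1)) ℝ :=
    Matrix.of fun r c : Fin (n + 1) => iteratedDeriv (r : ℕ) (f c) y with hM
  have hL : (Matrix.of fun r c : Fin (n + 1) => iteratedDeriv (r : ℕ)
      ((fun j => if j < n then f j else fun z => ∑ i ∈ Finset.range (n + 1), f i z) c) y) =
      M.updateCol (Fin.last n) (fun r => ∑ i, (1 : ℝ) • M r i) := by
    ext r c
    simp only [Matrix.of_apply, Matrix.updateCol_apply, one_smul, hM]
    by_cases hc : c = Fin.last n
    · subst hc
      simp only [Fin.val_last, lt_self_iff_false, if_false, if_true]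
      rw [iteratedDeriv_fun_sum (f := fun i z => f i z)
        (fun i hi => (hf i (Finset.mem_range.mp hi)).contDiffAt), Finset.sum_range]
    · have hclt : (c : ℕ) < n := Fin.val_lt_last hc
      simp [hclt, hc]
  change (Matrix.of fun r c : Fin (n + 1) => iteratedDeriv (r : ℕ)
      ((fun j => if j < n then f j else fun z => ∑ i ∈ Finset.range (n + 1), f i z) c) y).det =
    M.det
  rw [hL, Matrix.det_updateCol_sum, one_smul]

/-! ### Rolle's theorem for distinct zeros, in `ℕ∞` -/

/-- Rolle's theorem, counting DISTINCT zeros with values in `ℕ∞`: for `G` analytic on an open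
interval `Δ`, `Z_Δ(G) ≤ Z_Δ(G') + 1`. [cite: KoiranPortierTavenas2015, §5 (proof of Thm. 9:
"By Rolle's Theorem")] -/
theorem encard_zeros_le_encard_zeros_deriv_add_one {G : ℝ → ℝ} {Δ : Set ℝ}
    (hΔc : IsPreconnected Δ) (hG : AnalyticOnNhd ℝ G Δ) :
    {y | y ∈ Δ ∧ G y = 0}.encard ≤ {y | y ∈ Δ ∧ deriv G y = 0}.encard + 1 := by
  classical
  by_cases hfin : {y | y ∈ Δ ∧ deriv G y = 0}.Finite
  swap
  · rw [Set.Infinite.encard_eq hfin, top_add]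
    exact le_top
  -- every finite set of zeros of `G` in `Δ` has at most `#Z(G') + 1` elements
  have hbound : ∀ T : Finset ℝ, (∀ y ∈ T, y ∈ Δ ∧ G y = 0) → T.card ≤ hfin.toFinset.card + 1 := by
    intro T hT
    rcases Nat.eq_zero_or_pos T.card with h0 | hpos
    · omega
    obtain ⟨k, hk⟩ : ∃ k, T.card = k + 1 := ⟨T.card - 1, by omega⟩
    set t : Fin (k + 1) → ℝ := fun i => T.orderEmbOfFin hk i with htdef
    have ht : StrictMono t := fun i j hij => (T.orderEmbOfFin hk).strictMono hij
    have htmem : ∀ i, t i ∈ T := fun i => T.orderEmbOfFin_mem hk i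
    obtain ⟨c, hcmono, hcΔ, hc0, -⟩ := BD17.exists_strictMono_deriv_zeros hΔc hG t ht
      (fun i => (hT _ (htmem i)).1) (fun i => (hT _ (htmem i)).2)
    have hcmem : ∀ i, c i ∈ hfin.toFinset := fun i => by
      rw [Set.Finite.mem_toFinset]
      exact ⟨hcΔ i, hc0 i⟩
    have hcard : (Finset.univ.image c).card ≤ hfin.toFinset.card :=
      Finset.card_le_card (by
        intro x hx
        obtain ⟨i, -, rfl⟩ := Finset.mem_image.mp hx
        exact hcmem i)
    rw [Finset.card_image_of_injective _ hcmono.injective, Finset.card_univ, Fintype.card_fin]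
      at hcard
    omega
  have hZfin : {y | y ∈ Δ ∧ G y = 0}.Finite := by
    by_contra hinf
    obtain ⟨T, hTsub, hTcard⟩ := Set.Infinite.exists_subset_card_eq hinf (hfin.toFinset.card + 2)
    have := hbound T (fun y hy => hTsub (Finset.mem_coe.mpr hy))
    omega
  rw [hZfin.encard_eq_coe_toFinset_card, hfin.encard_eq_coe_toFinset_card]
  have := hbound hZfin.toFinset (fun y hy => by simpa [Set.Finite.mem_toFinset] using hy)
  exact_mod_cast this


/-! ### Frobenius' Lemma 21: the Wronskian recursion as a determinantal identity -/

/-- Lemma 4 with a last function `g`: on an open set on which `f_0` does not vanish,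
`W(f_0, …, f_m, g) = f_0^{m+2} · W((f_1/f_0)', …, (f_m/f_0)', (g/f_0)')`.
[cite: KoiranPortierTavenas2015, Lemma 4] -/
theorem wronskian_mix_div (f : ℕ → ℝ → ℝ) (g : ℝ → ℝ) (m : ℕ) {Δ : Set ℝ} (hΔ : IsOpen Δ)
    (hf : ∀ j < m + 1, AnalyticOnNhd ℝ (f j) Δ) (hg : AnalyticOnNhd ℝ g Δ)
    (h0 : ∀ z ∈ Δ, f 0 z ≠ 0) {y : ℝ} (hy : y ∈ Δ) :
    wronskian (fun j => if j < m + 1 then f j else g) (m + 2) y =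
      f 0 y ^ (m + 2) *
        wronskian (fun j => if j < m then (fun z => deriv (fun w => f (j + 1) w / f 0 w) z)
          else fun z => deriv (fun w => g w / f 0 w) z) (m + 1) y := by
  have hF : ∀ i < m + 1 + 1, AnalyticOnNhd ℝ ((fun j => if j < m + 1 then f j else g) i) Δ := by
    intro i hi
    by_cases him : i < m + 1
    · simp only [him, if_true]
      exact hf i him
    · simp only [him, if_false]
      exact hg
  have hF0 : ∀ z ∈ Δ, (fun j => if j < m + 1 then f j else g) 0 z ≠ 0 := by
    intro z hz
    simp only [Nat.zero_lt_succ, if_true]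
    exact h0 z hz
  have key := KPT2015_lemma_4_analytic (fun j => if j < m + 1 then f j else g) (m + 1) hΔ hF hF0 hy
  have e2 : wronskian (fun i z => deriv (fun w => (if i + 1 < m + 1 then f (i + 1) else g) w /
      (if 0 < m + 1 then f 0 else g) w) z) (m + 1) =
      wronskian (fun j => if j < m then (fun z => deriv (fun w => f (j + 1) w / f 0 w) z)
        else fun z => deriv (fun w => g w / f 0 w) z) (m + 1) := by
    refine wronskian_congr fun j _ => ?_
    funext z
    by_cases hjm : j < m
    · have h1 : j + 1 < m + 1 := by omega
      simp [hjm, h1]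
    · have h1 : ¬ (j + 1 < m + 1) := by omega
      simp [hjm, h1]
  rw [key, e2]
  simp

/-- The derivative of `w ↦ u(w)^{n+1} v(w)` at a point of differentiability. [folklore] -/
private theorem deriv_pow_succ_mul {u v : ℝ → ℝ} {n : ℕ} {z : ℝ} (hu : DifferentiableAt ℝ u z)
    (hv : DifferentiableAt ℝ v z) :
    deriv (fun w => u w ^ (n + 1) * v w) z =
      ((n : ℝ) + 1) * u z ^ n * deriv u z * v z + u z ^ (n + 1) * deriv v z := by
  rw [deriv_fun_mul (show DifferentiableAt ℝ (fun w => u w ^ (n + 1)) z from hu.pow (n + 1)) hv,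
    deriv_fun_pow hu (n + 1)]
  simp only [Nat.add_sub_cancel, Nat.cast_add, Nat.cast_one]

/-- **KPT 2015, Lemma 21 (Frobenius 1876), determinantal form.** For functions `f_0, …, f_i, g`
analytic on an open set `Δ` and every `y ∈ Δ`,
`W(f_0,…,f_{i−1})(y) · W(f_0,…,f_i, g)(y) = W(f_0,…,f_i)(y) · (W(f_0,…,f_{i−1}, g))'(y)
  − (W(f_0,…,f_i))'(y) · W(f_0,…,f_{i−1}, g)(y)`
(the Desnanot–Jacobi identity for Wronskian matrices). With `W_i = W(f_1,…,f_i)`, `W_0 = 1` and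
`R_i := W(f_1, …, f_i, R_0)` this is the printed recursion
"`R_{i+1} = (W_{i+1}²/W_i)(R_i/W_{i+1})'`" (p0011:L27–33) cleared of denominators:
`W_i R_{i+1} = W_{i+1} R_i' − W_{i+1}' R_i`. Proof: induction on `i`; where `f_0 ≠ 0`, Lemma 4
reduces `i + 1` to `i` for the family `((f_{j+1}/f_0)')_j`, `(g/f_0)'`, and the identity extends
across the zeros of `f_0` by the identity principle. [cite: KoiranPortierTavenas2015, Lemma 21] -/
theorem wronskian_frobenius (i : ℕ) :
    ∀ (f : ℕ → ℝ → ℝ) (g : ℝ → ℝ) {Δ : Set ℝ}, IsOpen Δ →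
      (∀ j < i + 1, AnalyticOnNhd ℝ (f j) Δ) → AnalyticOnNhd ℝ g Δ → ∀ y ∈ Δ,
      wronskian f i y * wronskian (fun j => if j < i + 1 then f j else g) (i + 2) y =
        wronskian f (i + 1) y *
            deriv (wronskian (fun j => if j < i then f j else g) (i + 1)) y -
          deriv (wronskian f (i + 1)) y *
            wronskian (fun j => if j < i then f j else g) (i + 1) y := by
  induction i with
  | zero =>
    intro f g Δ _ _ _ y _
    have h0 : (fun j : ℕ => if j < 0 then f j else g) = fun _ => g := by
      funext j
      simp
    rw [h0, wronskian_zero, wronskian_one, wronskian_two_apply]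
    have h1 : wronskian (fun _ : ℕ => g) 1 = g := wronskian_one _
    rw [h1]
    simp
    ring
  | succ i IH =>
    intro f g Δ hΔ hf hg y hy
    -- the level-`i+1` and level-`i+2` mixed families
    set F₁ : ℕ → ℝ → ℝ := fun j => if j < i + 1 then f j else g with hF₁
    set F₂ : ℕ → ℝ → ℝ := fun j => if j < i + 1 + 1 then f j else g with hF₂
    have hF₁an : ∀ {S : Set ℝ}, (∀ j < i + 2, AnalyticOnNhd ℝ (f j) S) → AnalyticOnNhd ℝ g S →
        ∀ j < i + 2, AnalyticOnNhd ℝ (F₁ j) S := by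
      intro S hfS hgS j _
      by_cases hj : j < i + 1
      · simp only [hF₁, hj, if_true]
        exact hfS j (by omega)
      · simp only [hF₁, hj, if_false]
        exact hgS
    have hF₂an : ∀ {S : Set ℝ}, (∀ j < i + 2, AnalyticOnNhd ℝ (f j) S) → AnalyticOnNhd ℝ g S →
        ∀ j < i + 3, AnalyticOnNhd ℝ (F₂ j) S := by
      intro S hfS hgS j _
      by_cases hj : j < i + 1 + 1
      · simp only [hF₂, hj, if_true]
        exact hfS j (by omega)
      · simp only [hF₂, hj, if_false]
        exact hgS
    -- a ball `B ⊆ Δ` around `y`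
    obtain ⟨ρ, hρ, hBΔ⟩ := Metric.isOpen_iff.mp hΔ y hy
    set B : Set ℝ := Metric.ball y ρ with hBdef
    have hBopen : IsOpen B := Metric.isOpen_ball
    have hBconn : IsPreconnected B := by
      rw [hBdef, Real.ball_eq_Ioo]
      exact isPreconnected_Ioo
    have hyB : y ∈ B := Metric.mem_ball_self hρ
    have hfB : ∀ j < i + 2, AnalyticOnNhd ℝ (f j) B := fun j hj z hz => hf j hj z (hBΔ hz)
    have hgB : AnalyticOnNhd ℝ g B := fun z hz => hg z (hBΔ hz)
    -- the difference of the two sides, analytic on `B`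
    set D : ℝ → ℝ := fun w =>
      wronskian f (i + 1) w * wronskian F₂ (i + 1 + 2) w -
        (wronskian f (i + 1 + 1) w * deriv (wronskian F₁ (i + 1 + 1)) w -
          deriv (wronskian f (i + 1 + 1)) w * wronskian F₁ (i + 1 + 1) w) with hDdef
    have hD_an : AnalyticOnNhd ℝ D B := by
      intro w hw
      have hW1 : AnalyticAt ℝ (wronskian f (i + 1)) w :=
        analyticAt_wronskian f (i + 1) fun j hj => hfB j (by omega) w hw
      have hW2 : AnalyticAt ℝ (wronskian f (i + 1 + 1)) w :=
        analyticAt_wronskian f (i + 1 + 1) fun j hj => hfB j (by omega) w hw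
      have hWF₁ : AnalyticAt ℝ (wronskian F₁ (i + 1 + 1)) w :=
        analyticAt_wronskian F₁ (i + 1 + 1) fun j hj => hF₁an hfB hgB j (by omega) w hw
      have hWF₂ : AnalyticAt ℝ (wronskian F₂ (i + 1 + 2)) w :=
        analyticAt_wronskian F₂ (i + 1 + 2) fun j hj => hF₂an hfB hgB j (by omega) w hw
      exact (hW1.mul hWF₂).sub ((hW2.mul hWF₁.deriv).sub (hW2.deriv.mul hWF₁))
    suffices hDzero : Set.EqOn D 0 B by
      have := hDzero hyB
      simp only [hDdef, Pi.zero_apply] at this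
      exact sub_eq_zero.mp this
    by_cases h0 : ∀ z ∈ B, f 0 z = 0
    · -- `f_0 ≡ 0` on `B`: every Wronskian with `f_0` as first column vanishes on `B`
      intro w hw
      have hev : f 0 =ᶠ[𝓝 w] fun _ => (0 : ℝ) :=
        Filter.eventually_of_mem (hBopen.mem_nhds hw) fun z hz => h0 z hz
      have e1 : wronskian f (i + 1) w = 0 :=
        wronskian_eq_zero_of_eventuallyEq_zero (j := 0) (by omega) hev
      have e2 : wronskian f (i + 1 + 1) w = 0 :=
        wronskian_eq_zero_of_eventuallyEq_zero (j := 0) (by omega) hev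
      have e3 : wronskian F₁ (i + 1 + 1) w = 0 :=
        wronskian_eq_zero_of_eventuallyEq_zero (j := 0) (by omega)
          (by simpa [hF₁] using hev)
      simp only [hDdef, Pi.zero_apply, e1, e2, e3, zero_mul, mul_zero, sub_zero]
    · -- a ball `B' ⊆ B` on which `f_0 ≠ 0`
      push Not at h0
      obtain ⟨y₀, hy₀B, hy₀⟩ := h0
      have hU : IsOpen (B ∩ (f 0) ⁻¹' {0}ᶜ) :=
        (hfB 0 (by omega)).continuousOn.isOpen_inter_preimage hBopen isOpen_compl_singleton
      obtain ⟨ε, hε, hball⟩ := Metric.isOpen_iff.mp hU y₀ ⟨hy₀B, hy₀⟩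
      set B' : Set ℝ := Metric.ball y₀ ε with hB'def
      have hB'B : B' ⊆ B := fun z hz => (hball hz).1
      have hB'0 : ∀ z ∈ B', f 0 z ≠ 0 := fun z hz => (hball hz).2
      have hB'open : IsOpen B' := Metric.isOpen_ball
      have hfB' : ∀ j < i + 2, AnalyticOnNhd ℝ (f j) B' := fun j hj z hz => hfB j hj z (hB'B hz)
      have hgB' : AnalyticOnNhd ℝ g B' := fun z hz => hgB z (hB'B hz)
      -- the transformed family on `B'`
      set φ : ℕ → ℝ → ℝ := fun j z => deriv (fun w => f (j + 1) w / f 0 w) z with hφdef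
      set γ : ℝ → ℝ := fun z => deriv (fun w => g w / f 0 w) z with hγdef
      have hφan : ∀ j < i + 1, AnalyticOnNhd ℝ (φ j) B' := fun j hj z hz =>
        ((hfB' (j + 1) (by omega) z hz).div (hfB' 0 (by omega) z hz) (hB'0 z hz)).deriv
      have hγan : AnalyticOnNhd ℝ γ B' := fun z hz =>
        ((hgB' z hz).div (hfB' 0 (by omega) z hz) (hB'0 z hz)).deriv
      set Ψ₀ : ℕ → ℝ → ℝ := fun j => if j < i then φ j else γ with hΨ₀
      set Ψ₁ : ℕ → ℝ → ℝ := fun j => if j < i + 1 then φ j else γ with hΨ₁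
      have hΨ₀an : ∀ j < i + 1, AnalyticOnNhd ℝ (Ψ₀ j) B' := by
        intro j _
        by_cases hj : j < i
        · simp only [hΨ₀, hj, if_true]
          exact hφan j (by omega)
        · simp only [hΨ₀, hj, if_false]
          exact hγan
      -- Lemma 4 on `B'`: the four Wronskians of the statement, divided by powers of `f_0`
      have L1a : ∀ w ∈ B', wronskian f (i + 1) w = f 0 w ^ (i + 1) * wronskian φ i w :=
        fun w hw => KPT2015_lemma_4_analytic f i hB'open (fun j hj => hfB' j (by omega)) hB'0 hw
      have L1b : ∀ w ∈ B', wronskian f (i + 1 + 1) w =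
          f 0 w ^ (i + 1 + 1) * wronskian φ (i + 1) w :=
        fun w hw => KPT2015_lemma_4_analytic f (i + 1) hB'open (fun j hj => hfB' j (by omega))
          hB'0 hw
      have L2a : ∀ w ∈ B', wronskian F₁ (i + 1 + 1) w = f 0 w ^ (i + 2) * wronskian Ψ₀ (i + 1) w :=
        fun w hw => wronskian_mix_div f g i hB'open (fun j hj => hfB' j (by omega)) hgB' hB'0 hw
      have L2b : ∀ w ∈ B', wronskian F₂ (i + 1 + 2) w =
          f 0 w ^ (i + 1 + 2) * wronskian Ψ₁ (i + 1 + 1) w :=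
        fun w hw => wronskian_mix_div f g (i + 1) hB'open (fun j hj => hfB' j (by omega)) hgB'
          hB'0 hw
      -- the induction hypothesis for the transformed family
      have hIH : ∀ z ∈ B', wronskian φ i z * wronskian Ψ₁ (i + 2) z =
          wronskian φ (i + 1) z * deriv (wronskian Ψ₀ (i + 1)) z -
            deriv (wronskian φ (i + 1)) z * wronskian Ψ₀ (i + 1) z :=
        IH φ γ hB'open hφan hγan
      -- the identity on `B'`
      have hDB' : ∀ z ∈ B', D z = 0 := by
        intro z hz
        have hz0 : f 0 z ≠ 0 := hB'0 z hz
        have hdf0 : DifferentiableAt ℝ (f 0) z := (hfB' 0 (by omega) z hz).differentiableAt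
        have hdA : DifferentiableAt ℝ (wronskian φ (i + 1)) z :=
          (analyticAt_wronskian φ (i + 1) fun j hj => hφan j hj z hz).differentiableAt
        have hdU : DifferentiableAt ℝ (wronskian Ψ₀ (i + 1)) z :=
          (analyticAt_wronskian Ψ₀ (i + 1) fun j hj => hΨ₀an j hj z hz).differentiableAt
        -- derivatives of `W(f_0..f_{i+1})` and `W(f_0..f_i, g)` at `z`
        have hd1 : deriv (wronskian f (i + 1 + 1)) z =
            ((i : ℝ) + 1 + 1) * f 0 z ^ (i + 1) * deriv (f 0) z * wronskian φ (i + 1) z +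
              f 0 z ^ (i + 1 + 1) * deriv (wronskian φ (i + 1)) z := by
          have hev : wronskian f (i + 1 + 1) =ᶠ[𝓝 z]
              fun w => f 0 w ^ (i + 1 + 1) * wronskian φ (i + 1) w :=
            Filter.eventually_of_mem (hB'open.mem_nhds hz) fun w hw => L1b w hw
          rw [hev.deriv_eq, deriv_pow_succ_mul hdf0 hdA]
          push_cast
          ring
        have hd2 : deriv (wronskian F₁ (i + 1 + 1)) z =
            ((i : ℝ) + 1 + 1) * f 0 z ^ (i + 1) * deriv (f 0) z * wronskian Ψ₀ (i + 1) z +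
              f 0 z ^ (i + 1 + 1) * deriv (wronskian Ψ₀ (i + 1)) z := by
          have hev : wronskian F₁ (i + 1 + 1) =ᶠ[𝓝 z]
              fun w => f 0 w ^ (i + 1 + 1) * wronskian Ψ₀ (i + 1) w :=
            Filter.eventually_of_mem (hB'open.mem_nhds hz) fun w hw => L2a w hw
          rw [hev.deriv_eq, deriv_pow_succ_mul hdf0 hdU]
          push_cast
          ring
        simp only [hDdef]
        rw [L1a z hz, L1b z hz, L2a z hz, L2b z hz, hd1, hd2]
        have key := hIH z hz
        linear_combination (f 0 z) ^ (2 * i + 4) * key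
      -- extend from `B'` to `B` by the identity principle
      have hev : D =ᶠ[𝓝 y₀] 0 :=
        Filter.eventually_of_mem (hB'open.mem_nhds (Metric.mem_ball_self hε)) fun z hz => hDB' z hz
      exact hD_an.eqOn_zero_of_preconnected_of_eventuallyEq_zero hBconn hy₀B hev


/-! ### The counting step of §5 (components of `I ∖ Z(W_{i+1})`) -/

/-- Gluing along the components of `Δ ∖ P` (cf. the proof of Thm. 8): if `X ⊆ Δ` (`Δ` an open
interval), every point of `P ∩ X` lies in `Y`, and on every open subinterval `J ⊆ Δ ∖ P` one has
`|X ∩ J| ≤ |Y ∩ J| + 1`, then `|X| ≤ |Y| + |P| + 1` (all cardinalities in `ℕ∞`; the `|P| + 1`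
components `J_c = {y ∈ Δ ∖ P : #{u ∈ P : u < y} = c}` are pairwise disjoint and disjoint from `P`).
[cite: KoiranPortierTavenas2015, Thm. 8 (proof) and §5 (proof of Thm. 9)] -/
theorem encard_le_of_components {Δ : Set ℝ} (hΔ : IsOpen Δ) (hΔc : IsPreconnected Δ)
    (P : Finset ℝ) {X Y : Set ℝ} (hX : X ⊆ Δ) (hP : ∀ u ∈ P, u ∈ X → u ∈ Y)
    (hJ : ∀ J : Set ℝ, IsOpen J → IsPreconnected J → J ⊆ Δ → (∀ y ∈ J, y ∉ P) →
      (X ∩ J).encard ≤ (Y ∩ J).encard + 1) :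
    X.encard ≤ Y.encard + P.card + 1 := by
  classical
  -- the counting function and the components `J_c` (as in the proof of Thm. 8)
  set cnt : ℝ → ℕ := fun y => (P.filter (fun u => u < y)).card with hcnt
  set J : ℕ → Set ℝ := fun c => {y | y ∈ Δ ∧ y ∉ P ∧ cnt y = c} with hJdef
  have hJΔ : ∀ c, J c ⊆ Δ := fun c y hy => hy.1
  have hJP : ∀ c, ∀ y ∈ J c, y ∉ P := fun c y hy => hy.2.1
  have hcnt_mono : ∀ {y y' : ℝ}, y ≤ y' → cnt y ≤ cnt y' := by
    intro y y' hyy'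
    simp only [hcnt]
    exact Finset.card_le_card fun u hu => by
      rw [Finset.mem_filter] at hu ⊢
      exact ⟨hu.1, lt_of_lt_of_le hu.2 hyy'⟩
  have hcnt_lt : ∀ {z y' : ℝ}, z ∈ P → z < y' → cnt z < cnt y' := by
    intro z y' hz hzy'
    simp only [hcnt]
    apply Finset.card_lt_card
    rw [Finset.ssubset_iff_of_subset (fun u hu => by
      rw [Finset.mem_filter] at hu ⊢
      exact ⟨hu.1, hu.2.trans hzy'⟩)]
    exact ⟨z, by simp [hz, hzy'], by simp⟩
  have hcnt_eq : ∀ {y y' : ℝ}, y ≤ y' → (∀ u ∈ P, ¬ (y ≤ u ∧ u < y')) → cnt y = cnt y' := by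
    intro y y' hyy' hno
    simp only [hcnt]
    congr 1
    ext u
    simp only [Finset.mem_filter, and_congr_right_iff]
    intro hu
    constructor
    · intro h
      exact lt_of_lt_of_le h hyy'
    · intro h
      by_contra hnot
      exact hno u hu ⟨not_lt.mp hnot, h⟩
  have hJord : ∀ c, (J c).OrdConnected := by
    intro c
    refine Set.ordConnected_iff.mpr fun y₁ hy₁ y₂ hy₂ _ z hz => ?_
    have hzΔ : z ∈ Δ := hΔc.ordConnected.out hy₁.1 hy₂.1 hz
    have hc₁ : cnt y₁ ≤ cnt z := hcnt_mono hz.1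
    have hc₂ : cnt z ≤ cnt y₂ := hcnt_mono hz.2
    rw [hy₁.2.2] at hc₁
    rw [hy₂.2.2] at hc₂
    have hzP : z ∉ P := by
      intro hzP
      have hne : z ≠ y₂ := fun h => hy₂.2.1 (h ▸ hzP)
      have hlt := hcnt_lt hzP (lt_of_le_of_ne hz.2 hne)
      rw [hy₂.2.2] at hlt
      omega
    exact ⟨hzΔ, hzP, by omega⟩
  have hJopen : ∀ c, IsOpen (J c) := by
    intro c
    rw [Metric.isOpen_iff]
    intro y₀ hy₀
    have hV : IsOpen (Δ \ (P : Set ℝ)) := hΔ.sdiff P.finite_toSet.isClosed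
    obtain ⟨ε, hε, hball⟩ := Metric.isOpen_iff.mp hV y₀ ⟨hy₀.1, hy₀.2.1⟩
    refine ⟨ε, hε, fun y hy => ?_⟩
    have hyV := hball hy
    refine ⟨hyV.1, hyV.2, ?_⟩
    have hno : ∀ u ∈ P, ¬ (min y y₀ ≤ u ∧ u ≤ max y y₀) := by
      rintro u hu ⟨h1, h2⟩
      have huball : u ∈ Metric.ball y₀ ε := by
        rw [Real.ball_eq_Ioo] at hy ⊢
        constructor
        · calc y₀ - ε < min y y₀ := lt_min hy.1 (by linarith)
            _ ≤ u := h1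
        · calc u ≤ max y y₀ := h2
            _ < y₀ + ε := max_lt hy.2 (by linarith)
      exact (hball huball).2 hu
    rw [← hy₀.2.2]
    rcases le_total y y₀ with hle | hle
    · exact hcnt_eq hle fun u hu h => hno u hu
        ⟨by rw [min_eq_left hle]; exact h.1, by rw [max_eq_right hle]; exact h.2.le⟩
    · exact (hcnt_eq hle fun u hu h => hno u hu
        ⟨by rw [min_eq_right hle]; exact h.1, by rw [max_eq_left hle]; exact h.2.le⟩).symm
  -- `X` is covered by `P` and the components `J_0, …, J_{|P|}`
  have hcover : X ⊆ (X ∩ (P : Set ℝ)) ∪ ⋃ c ∈ Finset.range (P.card + 1), (X ∩ J c) := by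
    intro y hy
    by_cases hyP : y ∈ P
    · exact Or.inl ⟨hy, hyP⟩
    · refine Or.inr ?_
      rw [Set.mem_iUnion₂]
      refine ⟨cnt y, Finset.mem_range.mpr (Nat.lt_succ_of_le ?_), hy, hX hy, hyP, rfl⟩
      exact Finset.card_filter_le _ _
  -- the pieces of `Y` are pairwise disjoint
  have hsum : ∀ n : ℕ, ∑ c ∈ Finset.range n, (Y ∩ J c).encard =
      (⋃ c ∈ Finset.range n, (Y ∩ J c)).encard := by
    intro n
    induction n with
    | zero => simp
    | succ n ih =>
      rw [Finset.sum_range_succ, ih, Finset.range_add_one, Finset.set_biUnion_insert,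
        Set.union_comm, Set.encard_union_eq]
      rw [Set.disjoint_left]
      intro y hy hy'
      rw [Set.mem_iUnion₂] at hy
      obtain ⟨c, hc, hyc⟩ := hy
      have h1 : cnt y = c := hyc.2.2.2
      have h2 : cnt y = n := hy'.2.2.2
      have := Finset.mem_range.mp hc
      omega
  have hdisjP : Disjoint (Y ∩ (P : Set ℝ)) (⋃ c ∈ Finset.range (P.card + 1), (Y ∩ J c)) := by
    rw [Set.disjoint_left]
    intro y hy hy'
    rw [Set.mem_iUnion₂] at hy'
    obtain ⟨c, -, hyc⟩ := hy'
    exact hyc.2.2.1 hy.2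
  have hYpieces : (Y ∩ (P : Set ℝ)).encard + ∑ c ∈ Finset.range (P.card + 1), (Y ∩ J c).encard ≤
      Y.encard := by
    rw [hsum, ← Set.encard_union_eq hdisjP]
    apply Set.encard_le_encard
    rintro y (hy | hy)
    · exact hy.1
    · rw [Set.mem_iUnion₂] at hy
      obtain ⟨c, -, hyc⟩ := hy
      exact hyc.1
  -- the pieces of `X`
  have hXP : (X ∩ (P : Set ℝ)).encard ≤ (Y ∩ (P : Set ℝ)).encard :=
    Set.encard_le_encard fun y hy => ⟨hP y hy.2 hy.1, hy.2⟩
  have hXJ : ∀ c, (X ∩ J c).encard ≤ (Y ∩ J c).encard + 1 := fun c =>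
    hJ (J c) (hJopen c) (hJord c).isPreconnected (hJΔ c) (hJP c)
  calc X.encard
      ≤ ((X ∩ (P : Set ℝ)) ∪ ⋃ c ∈ Finset.range (P.card + 1), (X ∩ J c)).encard :=
        Set.encard_le_encard hcover
    _ ≤ (X ∩ (P : Set ℝ)).encard + (⋃ c ∈ Finset.range (P.card + 1), (X ∩ J c)).encard :=
        Set.encard_union_le _ _
    _ ≤ (X ∩ (P : Set ℝ)).encard + ∑ c ∈ Finset.range (P.card + 1), (X ∩ J c).encard := by
        gcongr
        exact Finset.set_encard_biUnion_le _ _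
    _ ≤ (Y ∩ (P : Set ℝ)).encard + ∑ c ∈ Finset.range (P.card + 1), ((Y ∩ J c).encard + 1) :=
        add_le_add hXP (Finset.sum_le_sum fun c _ => hXJ c)
    _ = ((Y ∩ (P : Set ℝ)).encard + ∑ c ∈ Finset.range (P.card + 1), (Y ∩ J c).encard) +
          (P.card + 1 : ℕ) := by
        rw [Finset.sum_add_distrib, Finset.sum_const, Finset.card_range]
        push_cast
        ring
    _ ≤ Y.encard + (P.card + 1 : ℕ) := by
        gcongr
    _ = Y.encard + P.card + 1 := by
        push_cast
        ring

/-- **The counting step of §5, corrected.** For `R, S, V, W` analytic on an open interval `Δ`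
with `V · S = W · R' − W' · R` on `Δ` (for `R = R_i`, `S = R_{i+1}`, `V = W_i`, `W = W_{i+1}` this
is Lemma 21): `Z(R) ≤ Z(S) + Z(V) + Z(W) + 1` (distinct zeros in `Δ`, values in `ℕ∞`). Proof: off
the zero set `P` of `W`, `(R/W)' = VS/W²`, so on each of the `|P| + 1` components Rolle bounds the
zeros of `R` by those of `VS` plus one; AT a point of `P`, a zero of `R` is a zero of `VS` by the
identity. (The printed bookkeeping, p0011:L40–75, asserts more — "if `0 < m_x(R_i) < m_x(W_{i+1})`
then `m_x(R_{i+1}) ≥ m_x(W_{i+1}) − 1 > 0`" — which fails for `(f_1,f_2,f_3) = (x², x, 1)` at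
`x = 0`, where `m_0(R_1) = 1 < 2 = m_0(W_2)` but `R_2 = W_3 = −2`; the count `Z(R_{i+1}) ≥ Z(R_i)
− 1 − Z(W_{i+1}) − Z(W_i)` that the induction needs is exactly the present statement.)
[cite: KoiranPortierTavenas2015, Thm. 9 (proof, §5)] -/
theorem encard_zeros_le_of_wronskian_step {R S V W : ℝ → ℝ} {Δ : Set ℝ} (hΔ : IsOpen Δ)
    (hΔc : IsPreconnected Δ) (hR : AnalyticOnNhd ℝ R Δ) (hW : AnalyticOnNhd ℝ W Δ)
    (hid : ∀ y ∈ Δ, V y * S y = W y * deriv R y - deriv W y * R y) :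
    {y | y ∈ Δ ∧ R y = 0}.encard ≤
      {y | y ∈ Δ ∧ S y = 0}.encard + {y | y ∈ Δ ∧ V y = 0}.encard +
        {y | y ∈ Δ ∧ W y = 0}.encard + 1 := by
  classical
  by_cases hfin : {y | y ∈ Δ ∧ W y = 0}.Finite
  swap
  · rw [Set.Infinite.encard_eq hfin, add_top, top_add]
    exact le_top
  set P : Finset ℝ := hfin.toFinset with hPdef
  have hmemP : ∀ u, u ∈ P ↔ u ∈ Δ ∧ W u = 0 := fun u => by
    rw [hPdef, Set.Finite.mem_toFinset]
    rfl
  set Y : Set ℝ := {y | y ∈ Δ ∧ (S y = 0 ∨ V y = 0)} with hYdef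
  have hY : Y.encard ≤ {y | y ∈ Δ ∧ S y = 0}.encard + {y | y ∈ Δ ∧ V y = 0}.encard := by
    have : Y ⊆ {y | y ∈ Δ ∧ S y = 0} ∪ {y | y ∈ Δ ∧ V y = 0} := by
      rintro y ⟨hy, h | h⟩
      · exact Or.inl ⟨hy, h⟩
      · exact Or.inr ⟨hy, h⟩
    exact (Set.encard_le_encard this).trans (Set.encard_union_le _ _)
  have hmain := encard_le_of_components hΔ hΔc P (X := {y | y ∈ Δ ∧ R y = 0}) (Y := Y)
    (fun y hy => hy.1) ?_ ?_
  · calc {y | y ∈ Δ ∧ R y = 0}.encard ≤ Y.encard + P.card + 1 := hmain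
      _ ≤ ({y | y ∈ Δ ∧ S y = 0}.encard + {y | y ∈ Δ ∧ V y = 0}.encard) +
            {y | y ∈ Δ ∧ W y = 0}.encard + 1 := by
          rw [hfin.encard_eq_coe_toFinset_card]
          gcongr
  · -- at a zero `u` of `W`, a zero of `R` is a zero of `V · S`
    intro u hu hRu
    obtain ⟨huΔ, hWu⟩ := (hmemP u).mp hu
    have h := hid u huΔ
    rw [hWu, hRu.2, zero_mul, mul_zero, sub_zero] at h
    rcases mul_eq_zero.mp h with hV0 | hS0
    · exact ⟨huΔ, Or.inr hV0⟩
    · exact ⟨huΔ, Or.inl hS0⟩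
  · -- on a component `J` of `Δ ∖ P`: Rolle for `R / W`
    intro J hJo hJc hJΔ hJP
    have hW0 : ∀ y ∈ J, W y ≠ 0 := fun y hy h0 => hJP y hy ((hmemP y).mpr ⟨hJΔ hy, h0⟩)
    set φ : ℝ → ℝ := fun y => R y / W y with hφdef
    have hφ_an : AnalyticOnNhd ℝ φ J := fun y hy =>
      (hR y (hJΔ hy)).div (hW y (hJΔ hy)) (hW0 y hy)
    have hrolle := encard_zeros_le_encard_zeros_deriv_add_one hJc hφ_an
    have hXJ : {y | y ∈ Δ ∧ R y = 0} ∩ J = {y | y ∈ J ∧ φ y = 0} := by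
      ext y
      constructor
      · rintro ⟨⟨-, hRy⟩, hyJ⟩
        exact ⟨hyJ, by simp [hφdef, hRy]⟩
      · rintro ⟨hyJ, hφy⟩
        have : R y = 0 := by
          rcases (div_eq_zero_iff.mp hφy) with h | h
          · exact h
          · exact absurd h (hW0 y hyJ)
        exact ⟨⟨hJΔ hyJ, this⟩, hyJ⟩
    have hYJ : {y | y ∈ J ∧ deriv φ y = 0} ⊆ Y ∩ J := by
      rintro y ⟨hyJ, hdy⟩
      have hyΔ := hJΔ hyJ
      have hderiv : deriv φ y = (deriv R y * W y - R y * deriv W y) / W y ^ 2 :=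
        deriv_fun_div (hR y hyΔ).differentiableAt (hW y hyΔ).differentiableAt (hW0 y hyJ)
      rw [hderiv, div_eq_zero_iff] at hdy
      rcases hdy with hnum | hden
      · have hVS : V y * S y = 0 := by rw [hid y hyΔ]; linear_combination hnum
        rcases mul_eq_zero.mp hVS with hV0 | hS0
        · exact ⟨⟨hyΔ, Or.inr hV0⟩, hyJ⟩
        · exact ⟨⟨hyΔ, Or.inl hS0⟩, hyJ⟩
      · exact absurd (pow_eq_zero_iff two_ne_zero |>.mp hden) (hW0 y hyJ)
    rw [hXJ]
    exact hrolle.trans (add_le_add (Set.encard_le_encard hYJ) le_rfl)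

/-! ### Theorem 9 -/

/-- The iteration of the counting step along Frobenius' sequence `R_i = W(f_0, …, f_{i−1}, F)`,
`F = f_0 + ⋯ + f_{k−1}`: for every `m` with `m + 2 ≤ k`,
`Z(F) ≤ Z(R_{m+1}) + (m + 1) + Z(W_{m+1}) + 2 Σ_{j=1}^{m} Z(W_j)`.
[cite: KoiranPortierTavenas2015, Thm. 9 (proof, §5: "We will prove by induction that … `R_i` has at
least `Z(f_1+⋯+f_k) − i − Z(W_i) − 2Σ_{j<i} Z(W_j)` roots")] -/
theorem encard_zeros_sum_le_frobenius_iterate (k : ℕ) (f : ℕ → ℝ → ℝ) {Δ : Set ℝ}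
    (hΔ : IsOpen Δ) (hΔc : IsPreconnected Δ) (hf : ∀ j < k, AnalyticOnNhd ℝ (f j) Δ) :
    ∀ m, m + 2 ≤ k →
      {y | y ∈ Δ ∧ ∑ i ∈ Finset.range k, f i y = 0}.encard ≤
        {y | y ∈ Δ ∧ wronskian (fun j => if j < m + 1 then f j
            else fun z => ∑ i ∈ Finset.range k, f i z) (m + 2) y = 0}.encard +
          (m + 1 : ℕ) + {y | y ∈ Δ ∧ wronskian f (m + 1) y = 0}.encard +
          2 * ∑ j ∈ Finset.Icc 1 m, {y | y ∈ Δ ∧ wronskian f j y = 0}.encard := by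
  set F : ℝ → ℝ := fun z => ∑ i ∈ Finset.range k, f i z with hFdef
  have hF_an : AnalyticOnNhd ℝ F Δ := by
    intro y hy
    simp only [hFdef]
    exact Finset.analyticAt_fun_sum _ fun i hi => hf i (Finset.mem_range.mp hi) y hy
  -- `R_i` and the step `Z(R_i) ≤ Z(R_{i+1}) + Z(W_i) + Z(W_{i+1}) + 1`
  have hR_an : ∀ i, i + 1 ≤ k →
      AnalyticOnNhd ℝ (wronskian (fun j => if j < i then f j else F) (i + 1)) Δ := by
    intro i hi
    refine analyticOnNhd_wronskian _ _ fun j hj => ?_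
    by_cases hji : j < i
    · simp only [hji, if_true]
      exact hf j (by omega)
    · simp only [hji, if_false]
      exact hF_an
  have hstep : ∀ i, i + 2 ≤ k →
      {y | y ∈ Δ ∧ wronskian (fun j => if j < i then f j else F) (i + 1) y = 0}.encard ≤
        {y | y ∈ Δ ∧ wronskian (fun j => if j < i + 1 then f j else F) (i + 2) y = 0}.encard +
          {y | y ∈ Δ ∧ wronskian f i y = 0}.encard +
          {y | y ∈ Δ ∧ wronskian f (i + 1) y = 0}.encard + 1 := by
    intro i hi
    refine encard_zeros_le_of_wronskian_step hΔ hΔc (hR_an i (by omega))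
      (analyticOnNhd_wronskian f (i + 1) fun j hj => hf j (by omega)) fun y hy => ?_
    exact wronskian_frobenius i f F hΔ (fun j hj => hf j (by omega)) hF_an y hy
  -- `R_0 = F`
  have hR0 : wronskian (fun j => if j < 0 then f j else F) 1 = F := by
    have : (fun j : ℕ => if j < 0 then f j else F) = fun _ => F := by
      funext j
      simp
    rw [this, wronskian_one]
  -- `W_0` has no zeros
  have hW0 : {y | y ∈ Δ ∧ wronskian f 0 y = 0} = ∅ := by
    ext y
    simp [wronskian_zero]
  intro m
  induction m with
  | zero =>
    intro hk
    have h := hstep 0 hk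
    rw [hR0, hW0, Set.encard_empty, add_zero] at h
    have e : (2 : ℕ∞) * ∑ j ∈ Finset.Icc 1 0, {y | y ∈ Δ ∧ wronskian f j y = 0}.encard = 0 := by
      simp
    rw [e, add_zero]
    calc _ ≤ _ := h
      _ = _ := by
          push_cast
          ring
  | succ m ih =>
    intro hk
    have h1 := ih (by omega)
    have h2 := hstep (m + 1) (by omega)
    calc {y | y ∈ Δ ∧ ∑ i ∈ Finset.range k, f i y = 0}.encard
        ≤ _ := h1
      _ ≤ ({y | y ∈ Δ ∧ wronskian (fun j => if j < m + 1 + 1 then f j else F) (m + 1 + 2) y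
              = 0}.encard +
            {y | y ∈ Δ ∧ wronskian f (m + 1) y = 0}.encard +
            {y | y ∈ Δ ∧ wronskian f (m + 1 + 1) y = 0}.encard + 1) +
          (m + 1 : ℕ) + {y | y ∈ Δ ∧ wronskian f (m + 1) y = 0}.encard +
          2 * ∑ j ∈ Finset.Icc 1 m, {y | y ∈ Δ ∧ wronskian f j y = 0}.encard := by
          gcongr
      _ = {y | y ∈ Δ ∧ wronskian (fun j => if j < m + 1 + 1 then f j else F) (m + 1 + 2) y
              = 0}.encard +
          (m + 1 + 1 : ℕ) + {y | y ∈ Δ ∧ wronskian f (m + 1 + 1) y = 0}.encard +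
          2 * ∑ j ∈ Finset.Icc 1 (m + 1), {y | y ∈ Δ ∧ wronskian f j y = 0}.encard := by
          rw [Finset.sum_Icc_succ_top (by omega : 1 ≤ m + 1)]
          push_cast
          ring

/-- **KPT 2015, Theorem 9** (p0005:L91, proved in §5): "Let `f_1, …, f_k` be analytic linearly
independent functions on an interval `I`. Then
`Z(f_1 + ⋯ + f_k) ≤ k − 1 + Z(W_k) + Z(W_{k−1}) + 2 Σ_{j=1}^{k−2} Z(W_j)`" (`W_j = W(f_1,…,f_j)`,
`Z` = number of distinct zeros on `I`, in `ℕ ∪ {∞}`). Typed for an OPEN interval (`Δ` open and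
preconnected), the family indexed from `0` (`W_j = wronskian f j`), `1 ≤ k`, all counts in `ℕ∞`.
The printed hypothesis "linearly independent" is NOT needed and not assumed: it only serves to make
the right-hand side finite (Lemma 5); when some `W_j ≡ 0` the bound reads `Z ≤ ⊤`. Sharp: the
sibling `AnswerNo.lean`'s witness attains equality (`smoke_kpt_thm9_equality`), and dropping the
factor `2` is false (`tavenasWronskianBound_false`, `kpt_open_question_answer_is_no`). Proof as
printed (§5) — Frobenius' sequence `R_i = W(f_1,…,f_i, f_1+⋯+f_k)` (`R_0` the sum, `R_{k−1} = W_k`)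
and one Rolle step per `i` — with the multiplicity bookkeeping of p0011 replaced by the component
count `encard_zeros_le_of_wronskian_step` (see there for the printed sentence that fails).
-- TODO(general form): non-open intervals `I`.
[cite: KoiranPortierTavenas2015, Thm. 9] -/
theorem KPT2015_thm_9 (k : ℕ) (hk : 1 ≤ k) (f : ℕ → ℝ → ℝ) {Δ : Set ℝ} (hΔ : IsOpen Δ)
    (hΔc : IsPreconnected Δ) (hf : ∀ j < k, AnalyticOnNhd ℝ (f j) Δ) :
    {y | y ∈ Δ ∧ ∑ i ∈ Finset.range k, f i y = 0}.encard ≤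
      ((k - 1 : ℕ) : ℕ∞) + {y | y ∈ Δ ∧ wronskian f k y = 0}.encard +
        {y | y ∈ Δ ∧ wronskian f (k - 1) y = 0}.encard +
        2 * ∑ j ∈ Finset.Icc 1 (k - 2), {y | y ∈ Δ ∧ wronskian f j y = 0}.encard := by
  rcases Nat.lt_or_ge k 2 with hk2 | hk2
  · -- `k = 1`: the sum is `f_0 = W_1`
    obtain rfl : k = 1 := by omega
    have h1 : {y | y ∈ Δ ∧ ∑ i ∈ Finset.range 1, f i y = 0} =
        {y | y ∈ Δ ∧ wronskian f 1 y = 0} := by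
      ext y
      simp [wronskian_one_apply]
    rw [h1]
    simp only [Nat.sub_self, Nat.cast_zero, zero_add]
    exact le_add_right (le_add_right le_rfl)
  · obtain ⟨n, rfl⟩ : ∃ n, k = n + 2 := ⟨k - 2, by omega⟩
    have h := encard_zeros_sum_le_frobenius_iterate (n + 2) f hΔ hΔc hf n le_rfl
    -- `R_{k−1} = W_k`
    have hlast : {y | y ∈ Δ ∧ wronskian (fun j => if j < n + 1 then f j
        else fun z => ∑ i ∈ Finset.range (n + 2), f i z) (n + 2) y = 0} =
        {y | y ∈ Δ ∧ wronskian f (n + 2) y = 0} := by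
      ext y
      simp only [Set.mem_setOf_eq, and_congr_right_iff]
      intro hy
      rw [wronskian_lastCol_sum f (n + 1) fun j hj => hf j hj y hy]
    rw [hlast] at h
    have e1 : n + 2 - 1 = n + 1 := by omega
    have e2 : n + 2 - 2 = n := by omega
    rw [e1, e2]
    calc _ ≤ _ := h
      _ = _ := by ring

/-- **KPT 2015, Theorem 9 on `I = ℝ`**, in the sibling file's vocabulary (`realZeros`, `wronskian`):
for `f_0, …, f_{k−1}` analytic on `ℝ` (`k ≥ 1`),
`Z_ℝ(f_0 + ⋯ + f_{k−1}) ≤ (k − 1) + Z_ℝ(W_k) + Z_ℝ(W_{k−1}) + 2 Σ_{j=1}^{k−2} Z_ℝ(W_j)`.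
Compare `AnswerNo.TavenasWronskianBound` / `KPTWronskianBoundOnR` (the same with every coefficient
`1`), which are FALSE; equality here is attained by their refuting witness.
[cite: KoiranPortierTavenas2015, Thm. 9] -/
theorem KPT2015_thm_9_real (k : ℕ) (hk : 1 ≤ k) (f : ℕ → ℝ → ℝ)
    (hf : ∀ i < k, ∀ x : ℝ, AnalyticAt ℝ (f i) x) :
    realZeros (fun x => ∑ i ∈ Finset.range k, f i x) ≤
      ((k - 1 : ℕ) : ℕ∞) + realZeros (wronskian f k) + realZeros (wronskian f (k - 1)) +
        2 * ∑ j ∈ Finset.Icc 1 (k - 2), realZeros (wronskian f j) := by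
  have h := KPT2015_thm_9 k hk f isOpen_univ isPreconnected_univ (fun i hi x _ => hf i hi x)
  have hset : ∀ g : ℝ → ℝ, {y | y ∈ (Set.univ : Set ℝ) ∧ g y = 0} = {x | g x = 0} := by
    intro g
    ext x
    simp
  simp only [hset] at h
  exact h


/-- **Theorem 9 is attained**: for the sibling files' witness
`F = (x, x² − 1/2, x⁴ − 6x² − x + 9/2)` (`Witness.lean`),
`Z_ℝ(f_1+f_2+f_3) = 4 = (3 − 1) + Z_ℝ(W_3) + Z_ℝ(W_2) + 2 Z_ℝ(W_1)` (`= 2 + 0 + 0 + 2·1`; zero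
counts from `AnswerNo.lean`).
[cite: KoiranPortierTavenas2015, Thm. 9 and §6 (Thm. 25, "optimality")] -/
theorem KPT2015_thm_9_attained :
    realZeros (fun x => ∑ i ∈ Finset.range 3, F i x) =
      ((3 - 1 : ℕ) : ℕ∞) + realZeros (wronskian F 3) + realZeros (wronskian F (3 - 1)) +
        2 * ∑ j ∈ Finset.Icc 1 (3 - 2), realZeros (wronskian F j) := by
  rw [realZeros_sum]
  simp only [show (3 - 1 : ℕ) = 2 from rfl, show (3 - 2 : ℕ) = 1 from rfl, Finset.Icc_self,
    Finset.sum_singleton, realZeros_W1, realZeros_W2, realZeros_W3]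
  norm_num

end Literature.Computability.AlgebraicComplexity.KoiranPortierTavenas2015
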